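import Summits.NavierStokesRegularity.FluidComputer.GateBudgetSpentGate
import Summits.NavierStokesRegularity.FluidComputer.GateBudgetMemberClock
import HarnessLib

/-!
# What no tuning can beat, part 35: THE SPENT TOOTH — after firing, a half-lattice tooth keeps
# its clock reversed, its trigger doused and its carrier empty for 100 time units

Cell `pub-fluidc`, blueprint seat bp1 (gen 32, second item, headline); same namespace and
conventions as parts 1–34; imports part 34 (`GateBudgetSpentGate`: `knob_spent_gate`, which
carries part 26's Riccati floor `knob_drain_riccati` and the knob toolkit) and part 32
(`GateBudgetMemberClock`: `knob_member_state_headline_clock`, every member's state at its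
dousing time `T` with the clock level `b(T) ≤ -0.69ε`). Modes `0 = a` carrier, `1 = b` clock,
`2 = c` trigger, `3 = d` transfer, `4 = ã` output; `M = K¹⁰` throughout.
HONEST FRAMING (verbatim): low prior, high value-of-information experiment on Tao's machine
paradigm; NOT a claim that NS blows up.

THE POINT. Parts 31–33 certify every member of the window `200ε/K²⁰ ≤ ρ² ≤ 2ε/K¹⁰` silent
(no second trigger pulse) until `√(2 - 24 log K/K¹⁰) + 1.38` and no further, because the clock
of a DUD recovers at the full rate `ε`. For a half-lattice TOOTH `2ε = (2k+1)K¹⁰ρ²` part 32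
pins `|d(T)| ≥ 19931/20000` (`|sin wπ| = 1`, `cos wπ = 0`), so the output pair holds
`d(T)² + ã(T)² ≥ (19931/20000)² = 1 - η`, `η = 2755239/4·10⁸ ≈ 0.00689`: the carrier that pumps
the clock is EMPTY, and part 34's spent-gate law applies with `β = 0.69ε`,
`λ₀ = K⁻¹⁰ + 4e^{-K¹⁰}/K¹⁰`, `H = 100` — budget `100η + 5000λ₀ + e^{-K¹⁰}10⁶/6 < 0.69`
(`spent_headline_numerics`: `100η = 0.68881`, the rest `< 2·10⁻⁷` at `K ≥ 16`). §102
(`knob_tooth_spent_state`, at the member's own `T`): for every `r ∈ [T, T + 100]`,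
`c(r) ≤ 2ρ²/K¹⁰` (twice the ENTRY level — NO SECOND PULSE), `b(r) ≤ -0.69ε + 0.007ε(r - T)`
(the clock recovers at `≤ 0.7%` of the dud's rate), `a(r)² ≤ 7/1000` (carrier empty),
`d(r)² + ã(r)² ≥ 993/1000`. §103 (`knob_tooth_spent`, on the ABSOLUTE clock, using part 32's
`√(2 - 24 log K/K¹⁰) ≤ s₀ < T ≤ √(2 + 2/K¹⁰) + 242/K⁹`): the same four bounds for every
`t ∈ [√(2 + 2/K¹⁰) + 242/K⁹, √(2 - 24 log K/K¹⁰) + 100]`, and — part 26's Riccati drain on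
`[T, T + 1]` where `d² + ã² ≥ 0.993`, then monotonicity of the output — the tooth's output is
`ã(t) ≥ √0.993·tanh(√0.993·K)` (`≥ 0.9964` at `K = 16`) for EVERY `t ≥ √(2 + 2/K¹⁰) + 242/K⁹
+ 1`, forever (part 29's floor was `0.996·tanh(0.1245K)`, `0.96` at `K = 16`). READING (the
dichotomy of Tao's gate family at `M = K¹⁰`): a TOOTH is a ONE-SHOT switch — after firing near
`√2` it sits at `(a, b, c, d, ã) ≈ (0, -√2ε↗, 0, 0, 1)` with nothing moving for at least `100`
time units (`≈ 70` critical times), its clock short of zero throughout; a DUD is certified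
silent only until `√2 + 1.38` (part 33) and is expected to re-arm near `√2 + 2√2` (part 31,
HONEST LIMIT (i)). Whatever a downstream stage reads from a tooth after `√2 + 1.07`, it reads
the same thing at every later time up to `√2 + 100`.

HONEST LIMITS. (i) The horizon `100` is where THIS certificate ends, set by the slack of part
28's pin (`η ≈ 0.0069`), not by the dynamics (part 34, HONEST LIMIT (i)); the clock bound
`-0.69ε + 0.007ε(t - T)` is within `0.01ε` of zero at the horizon and says nothing after.
(ii) One-sided throughout; in particular nothing says the dud re-fires. (iii) The output floor
`√0.993·tanh(√0.993·K)` is symbolic in `tanh` (no decimal is typed; `tanh(15.9) > 1 - 10⁻¹³`).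
(iv) Half-lattice teeth only (`|sin wπ| = 1`); a general member with pin `L ≤ |d(T)|` obeys
part 34 with `η = 1 - L²` and horizon `≍ 0.69/(1 - L²)` — not restated. (v) Numbers at
`M = K¹⁰`, `K ≥ 16`, `w ∈ [1/2, K¹⁰/200]` only. (vi) Nothing about Navier–Stokes.
[cite: Tao2016AveragedNS, §5.5 Theorem 5.3, (5.5), (5.6), (b-eq), (c-eq), (energy-con), (tcable)]
-/

noncomputable section

namespace Summit.NavierStokesRegularity.FluidComputer.GateBudget

open Real Set Filter Topology
open Literature.Analysis.FluidPDE.Tao2016AveragedNS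

/-! ## §101 Headline numerics at `M = K¹⁰`, `β = 0.69ε`, `H = 100` -/

/-- `e^{-K¹⁰} ≤ 2/K²⁰` for `K ≥ 16` (`x²/2 ≤ eˣ`). [cite: Tao2016AveragedNS, §5.5 (5.5)] -/
theorem spent_exp_le {K : ℝ} (hK : 16 ≤ K) : exp (-K ^ 10) ≤ 2 / K ^ 20 := by
  have hK0 : 0 < K := by linarith
  have h := Real.pow_div_factorial_le_exp (K ^ 10) (by positivity) 2
  norm_num [Nat.factorial] at h
  rw [Real.exp_neg, inv_eq_one_div, div_le_div_iff₀ (exp_pos _) (by positivity)]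
  nlinarith [h]

/-- The four numeric facts of the spent tooth at `M = K¹⁰` (`K ≥ 16`; `q = K⁻¹⁰`,
`e = e^{-K¹⁰} ≤ 2q²`, `λ₀ = (1 + 4e)q`, `η = 2755239/4·10⁸`): the budget
`100η + 5000λ₀ + 10⁶e/6 < 0.69`; the clock-rate coefficient `η + 50λ₀ + 10⁴e/6 ≤ 7/1000`; the
trigger level `λ₀ + 100e ≤ 2q`; the dose `100λ₀ + 5000e ≤ 10⁻⁴`.
[cite: Tao2016AveragedNS, §5.5 (5.5)] -/
theorem spent_headline_numerics {K : ℝ} (hK : 16 ≤ K) :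
    2755239 / 400000000 * 100 + (1 + 4 * exp (-K ^ 10)) * (1 / K ^ 10) * 100 ^ 2 / 2
          + exp (-K ^ 10) * 100 ^ 3 / 6 < (69 : ℝ) / 100 ∧
      2755239 / 400000000 + 50 * ((1 + 4 * exp (-K ^ 10)) * (1 / K ^ 10))
          + 10000 / 6 * exp (-K ^ 10) ≤ (7 : ℝ) / 1000 ∧
      (1 + 4 * exp (-K ^ 10)) * (1 / K ^ 10) + exp (-K ^ 10) * 100 ≤ 2 * (1 / K ^ 10) ∧
      100 * ((1 + 4 * exp (-K ^ 10)) * (1 / K ^ 10)) + exp (-K ^ 10) * 100 ^ 2 / 2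
          ≤ (1 : ℝ) / 10000 := by
  have hK0 : 0 < K := by linarith
  have h10 : (1099511627776 : ℝ) ≤ K ^ 10 := by
    have := headline_pow_floor hK 10; norm_num at this; exact this
  have hq0 : (0 : ℝ) ≤ 1 / K ^ 10 := by positivity
  have he0 : 0 ≤ exp (-K ^ 10) := (exp_pos _).le
  have hq : (1 : ℝ) / K ^ 10 ≤ 1 / 1099511627776 :=
    div_le_div_of_nonneg_left (by norm_num) (by norm_num) h10
  have he : exp (-K ^ 10) ≤ 2 * (1 / K ^ 10 * (1 / K ^ 10)) := by
    have h := spent_exp_le hK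
    have hv : (2 : ℝ) / K ^ 20 = 2 * (1 / K ^ 10 * (1 / K ^ 10)) := by ring
    linarith
  have hqq : 1 / K ^ 10 * (1 / K ^ 10) ≤ 1 / 1099511627776 * (1 / K ^ 10) :=
    mul_le_mul_of_nonneg_right hq hq0
  have heq : exp (-K ^ 10) * (1 / K ^ 10) ≤ exp (-K ^ 10) * (1 / 1099511627776) :=
    mul_le_mul_of_nonneg_left hq he0
  have hp1 : 0 ≤ exp (-K ^ 10) * (1 / K ^ 10) := mul_nonneg he0 hq0
  have hp2 : 0 ≤ 1 / K ^ 10 * (1 / K ^ 10) := mul_nonneg hq0 hq0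
  refine ⟨by linarith, by linarith, by linarith, by linarith⟩

section Headline

variable {K ε ρ : ℝ} {X : ℝ → Fin 5 → ℝ} {C : ℝ → ℝ}

/-! ## §102 The spent tooth at its own dousing time -/

/-- **THE SPENT TOOTH (MEMBER'S CLOCK).** Along `rotorCircuit K K¹⁰ ε ρ` from (5.6) (`K ≥ 16`,
`0 < ε`, `0 < ρ`): if at `T ≥ 0` the clock is at `b(T) ≤ -0.69ε`, the residue at
`c(T) ≤ (K⁻¹⁰ + 4e^{-K¹⁰}/K¹⁰)ρ²` and the transfer mode pinned `|d(T)| ≥ 19931/20000` (part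
32's state of a half-lattice tooth), then for every `r ∈ [T, T + 100]`: `c(r) ≤ 2ρ²/K¹⁰`,
`b(r) ≤ -0.69ε + 0.007ε(r - T)`, `a(r)² ≤ 7/1000`, `d(r)² + ã(r)² ≥ 993/1000` — part 34's
`knob_spent_gate` with `η = 1 - (19931/20000)²`, `H = 100`, and §101.
[cite: Tao2016AveragedNS, §5.5 Theorem 5.3, (5.5), (b-eq), (c-eq), (energy-con)] -/
theorem knob_tooth_spent_state
    (hX : ∀ t, HasDerivAt X (RotorKnob.rotorCircuit K (K ^ 10) ε ρ (X t)) t)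
    (h0 : X 0 = delayInit) (hK : 16 ≤ K) (hε : 0 < ε) (hρ : 0 < ρ) {T : ℝ} (hT : 0 ≤ T)
    (hbT : X T 1 ≤ -(69 / 100 * ε))
    (hcT : X T 2 ≤ (1 / K ^ 10 + 4 * exp (-K ^ 10) / K ^ 10) * ρ ^ 2)
    (hpin : 19931 / 20000 ≤ |X T 3|) {r : ℝ} (hr : r ∈ Icc T (T + 100)) :
    X r 2 ≤ 2 * ρ ^ 2 / K ^ 10 ∧ X r 1 ≤ -(69 / 100 * ε) + 7 / 1000 * ε * (r - T) ∧
      X r 0 ^ 2 ≤ 7 / 1000 ∧ 993 / 1000 ≤ X r 3 ^ 2 + X r 4 ^ 2 := by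
  have hK0 : 0 < K := by linarith
  have hK10 : 0 < K ^ 10 := by positivity
  obtain ⟨hna, hnb, hnc, hnd⟩ := spent_headline_numerics hK
  have he0 : 0 ≤ exp (-K ^ 10) := (exp_pos _).le
  have hl0 : 0 ≤ (1 + 4 * exp (-K ^ 10)) * (1 / K ^ 10) := by positivity
  -- the output pair of the tooth holds `1 - η`
  have hη : 1 - 2755239 / 400000000 ≤ X T 3 ^ 2 + X T 4 ^ 2 := by
    have h := pow_le_pow_left₀ (by norm_num) hpin 2
    rw [sq_abs] at h
    norm_num at h
    nlinarith [sq_nonneg (X T 4)]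
  have hlam : 1 / K ^ 10 + 4 * exp (-K ^ 10) / K ^ 10
      = (1 + 4 * exp (-K ^ 10)) * (1 / K ^ 10) := by ring
  rw [hlam] at hcT
  have hbud : ε * (2755239 / 400000000 * 100
      + (1 + 4 * exp (-K ^ 10)) * (1 / K ^ 10) * 100 ^ 2 / 2 + exp (-K ^ 10) * 100 ^ 3 / 6)
      < 69 / 100 * ε := lt_of_lt_of_eq (mul_lt_mul_of_pos_left hna hε) (mul_comm _ _)
  obtain ⟨hb, hc, hs, ha⟩ := knob_spent_gate (H := 100) hX h0 hε hρ hK10.le hT hbT hcT hη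
    (by norm_num) hbud hr
  have hτ0 : 0 ≤ r - T := by linarith [hr.1]
  have hτ1 : r - T ≤ 100 := by linarith [hr.2]
  have hτ2 : (r - T) ^ 2 ≤ 100 * (r - T) := by nlinarith
  have hτ3 : (r - T) ^ 3 ≤ 10000 * (r - T) := by nlinarith
  have hτsq : (r - T) ^ 2 ≤ 100 ^ 2 := pow_le_pow_left₀ hτ0 hτ1 2
  -- the dose on `[T, T + 100]` is below `10⁻⁴`
  have hdose : (1 + 4 * exp (-K ^ 10)) * (1 / K ^ 10) * (r - T) + exp (-K ^ 10) * (r - T) ^ 2 / 2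
      ≤ 1 / 10000 := by
    have h1 := mul_le_mul_of_nonneg_left hτ1 hl0
    have h2 := mul_le_mul_of_nonneg_left hτsq he0
    linarith
  refine ⟨?_, ?_, by linarith, by linarith⟩
  · -- trigger: `λ₀ + e^{-K¹⁰}(r - T) ≤ λ₀ + 100e^{-K¹⁰} ≤ 2/K¹⁰`
    have h1 := mul_le_mul_of_nonneg_left hτ1 he0
    have h2 : ((1 + 4 * exp (-K ^ 10)) * (1 / K ^ 10) + exp (-K ^ 10) * (r - T)) * ρ ^ 2
        ≤ 2 * (1 / K ^ 10) * ρ ^ 2 :=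
      mul_le_mul_of_nonneg_right (by linarith) (sq_nonneg ρ)
    rw [show 2 * ρ ^ 2 / K ^ 10 = 2 * (1 / K ^ 10) * ρ ^ 2 by ring]
    exact hc.trans h2
  · -- clock: `η(r - T) + λ₀(r - T)²/2 + e(r - T)³/6 ≤ (r - T)(η + 50λ₀ + 10⁴e/6) ≤ 0.007(r - T)`
    have h1 := mul_le_mul_of_nonneg_left hτ2 hl0
    have h2 := mul_le_mul_of_nonneg_left hτ3 he0
    have h3 := mul_le_mul_of_nonneg_left hnb hτ0
    have hbr : 2755239 / 400000000 * (r - T)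
        + (1 + 4 * exp (-K ^ 10)) * (1 / K ^ 10) * (r - T) ^ 2 / 2
        + exp (-K ^ 10) * (r - T) ^ 3 / 6 ≤ (r - T) * (7 / 1000) := by
      linarith
    have h4 := mul_le_mul_of_nonneg_left hbr hε.le
    linarith

/-! ## §103 The spent tooth on the absolute clock -/

/-- **THE SPENT TOOTH.** For `K ≥ 16`, `0 < ε`, `ε² ≤ 1/(6K²⁰)` and an exact trajectory of
`rotorCircuit K K¹⁰ ε ρ` from (5.6), every half-lattice tooth `2ε = (2k+1)K¹⁰ρ²` of the window
`200ε/K²⁰ ≤ ρ² ≤ 2ε/K¹⁰` satisfies, for EVERY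
`t ∈ [√(2 + 2/K¹⁰) + 242/K⁹, √(2 - 24 log K/K¹⁰) + 100]`: `c(t) ≤ 2ρ²/K¹⁰` (NO SECOND PULSE),
`b(t) ≤ -0.69ε + 0.007ε(t - √(2 - 24 log K/K¹⁰))` (clock short of zero), `a(t)² ≤ 7/1000`
(carrier empty), `d(t)² + ã(t)² ≥ 993/1000`; and its output is
`ã(t) ≥ √0.993·tanh(√0.993·K)` for EVERY `t ≥ √(2 + 2/K¹⁰) + 242/K⁹ + 1` — part 32's state,
§102 on `[T, T + 100] ⊇` the window, part 26's `knob_drain_riccati` on `[T, T + 1]`, and the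
monotone output. A tooth is a one-shot switch; compare the dud's `1.38` (part 33).
[cite: Tao2016AveragedNS, §5.5 Theorem 5.3, (5.5), (5.6), (b-eq), (c-eq), (energy-con), (tcable)]
-/
theorem knob_tooth_spent
    (hX : ∀ t, HasDerivAt X (RotorKnob.rotorCircuit K (K ^ 10) ε ρ (X t)) t)
    (h0 : X 0 = delayInit) (hC : ∀ t, HasDerivAt C (X t 2) t) (hK : 16 ≤ K) (hε : 0 < ε)
    (hεK : ε ^ 2 ≤ 1 / (6 * K ^ 20)) (hρ : 0 < ρ) (hlo : 200 * ε / K ^ 20 ≤ ρ ^ 2)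
    (hhi : K ^ 10 * ρ ^ 2 ≤ 2 * ε) (k : ℕ) (hk : 2 * ε = (2 * k + 1) * K ^ 10 * ρ ^ 2) :
    (∀ t ∈ Icc (√(2 + 2 / K ^ 10) + 242 / K ^ 9) (√(2 - 24 * Real.log K / K ^ 10) + 100),
      X t 2 ≤ 2 * ρ ^ 2 / K ^ 10 ∧
      X t 1 ≤ -(69 / 100 * ε) + 7 / 1000 * ε * (t - √(2 - 24 * Real.log K / K ^ 10)) ∧
      X t 0 ^ 2 ≤ 7 / 1000 ∧ 993 / 1000 ≤ X t 3 ^ 2 + X t 4 ^ 2) ∧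
    (∀ t, √(2 + 2 / K ^ 10) + 242 / K ^ 9 + 1 ≤ t →
      √(993 / 1000) * tanh (√(993 / 1000) * K) ≤ X t 4) := by
  have hK0 : 0 < K := by linarith
  obtain ⟨s₀, T, hsq1, hsq2, hs1, -, hsT, hTs, -, hcT, -, -, -, -, hd2, hb69⟩ :=
    knob_member_state_headline_clock hX h0 hC hK hε hεK hρ hlo hhi
  -- half-way between lattice points `wπ = kπ + π/2`: `|sin| = 1`, `cos = 0` (as in part 29)
  have hw : ε / (K ^ 10 * ρ ^ 2) * π = k * π + π / 2 := by
    have : ε / (K ^ 10 * ρ ^ 2) = k + 1 / 2 := by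
      rw [div_eq_iff (by positivity)]; linarith
    rw [this]; ring
  have hs : |sin (ε / (K ^ 10 * ρ ^ 2) * π)| = 1 := by
    rw [hw, Real.sin_add_pi_div_two]; exact_mod_cast Real.abs_cos_int_mul_pi k
  have hc : |cos (ε / (K ^ 10 * ρ ^ 2) * π)| = 0 := by
    rw [hw, Real.cos_add_pi_div_two, abs_neg, Real.sin_nat_mul_pi, abs_zero]
  rw [hs, hc] at hd2
  have hpin : 19931 / 20000 ≤ |X T 3| := by linarith
  have hs0 : 0 ≤ s₀ := by linarith
  have hT0 : 0 ≤ T := by linarith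
  have hlow : √(2 - 24 * Real.log K / K ^ 10) ≤ s₀ := (Real.sqrt_le_left hs0).2 hsq1
  have hup : s₀ ≤ √(2 + 2 / K ^ 10) := Real.le_sqrt_of_sq_le hsq2
  have state := fun r (hr : r ∈ Icc T (T + 100)) =>
    knob_tooth_spent_state hX h0 hK hε hρ hT0 hb69 hcT hpin hr
  refine ⟨fun t ht => ?_, fun t ht => ?_⟩
  · have ht' : t ∈ Icc T (T + 100) := ⟨by linarith [ht.1], by linarith [ht.2]⟩
    obtain ⟨h2, h1, ha, hd⟩ := state t ht'
    refine ⟨h2, ?_, ha, hd⟩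
    have hmono : 7 / 1000 * ε * (t - T) ≤ 7 / 1000 * ε * (t - √(2 - 24 * Real.log K / K ^ 10)) :=
      mul_le_mul_of_nonneg_left (by linarith) (by positivity)
    linarith
  · -- the Riccati drain on `[T, T + 1]`, where `d² + ã² ≥ 0.993`, then the monotone output
    have hm : ∀ r ∈ Icc T (T + 1), 993 / 1000 ≤ X r 3 ^ 2 + X r 4 ^ 2 := fun r hr =>
      (state r ⟨hr.1, by linarith [hr.2]⟩).2.2.2
    have hric := knob_drain_riccati hX hK0.le (by norm_num) (RotorKnob.e_nonneg hX h0 hK0.le hT0)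
      hm (t := T + 1) ⟨by linarith, le_rfl⟩
    rw [show K * √(993 / 1000) * (T + 1 - T) = √(993 / 1000) * K by ring] at hric
    have hmon : Monotone fun t => X t 4 := RotorKnob.rotorCircuit_output_monotone hK0.le hX
    exact hric.trans (hmon (show T + 1 ≤ t by linarith))

end Headline

end Summit.NavierStokesRegularity.FluidComputer.GateBudget
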